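import Literature.RepresentationTheory.MoeglinVignerasWaldspurger1987.RankOneThetaTorusLemmas
import Literature.RepresentationTheory.MoeglinVignerasWaldspurger1987.RankOneScalarCocycle
import Literature.NumberTheory.Weil1964.WeilGaussCrossRatio
import Literature.RepresentationTheory.PartialCharacterExtension
import HarnessLib

/-!
# The `(U(1), U(1))` theta dichotomy, character route: the finite-level characters of the two rank-one oscillator
# representations of `U(J₁)(F_v)` attached to lines in different classes satisfy `tr ω₂ = -θ · tr ω₁` off `{±1}`

[MoeglinVignerasWaldspurger1987] C. Mœglin, M.-F. Vignéras, J.-L. Waldspurger, LNM 1291, Chap. 3 §IV (theta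
dichotomy for unitary groups over a `p`-adic field), rank `1 × 1` case, via A. Weil, Acta Math. 111 (1964):
for the torus `T = U(J₁)(F_v) = E_v¹` at a non-split place `v` and two trace-zero `δ₁`, `δ₂ = α δ₁` with
`(α, d₁)_v = -1` (`δ₁² = d₁`; the skew-hermitian lines `δ₁ J₁`, `δ₂ J₁` lie in different classes), the oscillator
representations `ωᵢ = ω_{sᵢ}` of `T` (sections `sᵢ` over `ι_{δᵢ}`) have finite-level characters related by
**`rankOne_theta_character_ratio`**: there is a character `θ : T →* ℂˣ` with open kernel such that for every
`z ∉ {1, -1}` and every small open `L`, `tr(ω₂(u) | 𝒮^L) = -θ(u) · tr(ω₁(u) | 𝒮^L)` for `u` near `z` — the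
hypothesis `hrel` of ★ `TwistedCoinv.finrank_weightSpace_add_eq_one_of_trace_eq_neg`.  Ingredients: the explicit
trace formula ★ `rankOne_torusTrace_eq_explicit`, the Schur cocycle ★ `rankOne_scalar_cocycle`, the cross-line
identity ★ `crossLine_character_identity` (sign `(α, d₁)_v`), Weil's extension trick ★
`exists_monoidHom_eq_off_pair` on the infinite group `T` (Cayley points ★ `exists_cayley_unit`).  (Torus lemmas:
★ `RankOneThetaTorusLemmas`.)  THEOREMS ONLY (cell
`hodgecm-mathlib`, SOCKETS-H413 §3 S6 «G2a»); count-neutral; HC_CM is proved only modulo the 7 printed citations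
until rung 0 closes.

## References
* [MoeglinVignerasWaldspurger1987] LNM 1291 (1987), Chap. 2 II.1 (A), II.8; Chap. 3 §IV.4.
* [Weil1964] A. Weil, Acta Math. 111 (1964) 143–211, Chap. I n° 14, Chap. IV n° 42–44.
* [PlatonovRapinchuk1994] V. Platonov, A. Rapinchuk, *Algebraic groups and number theory*, §6.2.
-/

set_option autoImplicit false

noncomputable section

open NumberField IsDedekindDomain Matrix MeasureTheory
open scoped Matrix MatrixGroups NNReal Topology
open Literature.RepresentationTheory Literature.RepresentationTheory.HeisenbergGroup
open Literature.RepresentationTheory.TwistedCoinv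
open Literature.NumberTheory.GelbartRogawski1991.UnitaryDualPair.LocalSplitting
open Literature.NumberTheory.Automorphic Literature.NumberTheory.Automorphic.UnitaryGroup
open Literature.NumberTheory.Automorphic.Liu2021
open Literature.NumberTheory.GaloisRepresentations.IsNonarchimedeanLocalField
open Literature.NumberTheory.Weil1964 Literature.NumberTheory.QuadraticForms

namespace Literature.RepresentationTheory.MoeglinVignerasWaldspurger1987

/-! ## §3 Two lines in different classes: `tr ω₂ = -θ · tr ω₁` off `{±1}` -/

section TwoLines

variable (F : Type) [Field F] [NumberField F] (E : Type) [Field E] [NumberField E] [Algebra F E]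
  [Algebra.IsQuadraticExtension F E] (c : E ≃ₐ[F] E)
  (δ₁ : E) (hcδ₁ : c δ₁ = -δ₁) (hδ₁ : δ₁ ≠ 0) (d₁ : F) (hd₁ : δ₁ * δ₁ = algebraMap F E d₁)
  (δ₂ : E) (hcδ₂ : c δ₂ = -δ₂) (hδ₂ : δ₂ ≠ 0) (d₂ : F) (hd₂ : δ₂ * δ₂ = algebraMap F E d₂)
  (α : F) (hα0 : α ≠ 0) (hα : δ₂ = algebraMap F E α * δ₁)
  (t : Matrix (Fin 1) (Fin 1) F) (ht : t.IsSymm) (htd : IsUnit t.det)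
  (J₁ : Matrix (Fin 1) (Fin 1) E) (hJ₁ : J₁ = t.map (algebraMap F E)) (v : HeightOneSpectrum (𝓞 F))
  (hE : IsField (UnitaryGroup.LocalRing E v))
  (s₁ : localPi E c 1 J₁ v →* LocalMp F 1 t v)
  (hs₁ : ∀ g, MpPsi.proj _ (s₁ g) = iota F E c 1 hcδ₁ hδ₁ hd₁ t ht hJ₁ v g)
  (hsm₁ : Representation.IsSmooth ((MpPsi.toRep (localSchrodinger F 1 t v)).comp s₁))
  (s₂ : localPi E c 1 J₁ v →* LocalMp F 1 t v)
  (hs₂ : ∀ g, MpPsi.proj _ (s₂ g) = iota F E c 1 hcδ₂ hδ₂ hd₂ t ht hJ₁ v g)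
  (hsm₂ : Representation.IsSmooth ((MpPsi.toRep (localSchrodinger F 1 t v)).comp s₂))

include hcδ₁ hδ₁ hd₁ hcδ₂ hδ₂ hd₂ hα0 hα ht htd hJ₁ hE hs₁ hsm₁ hs₂ hsm₂ in
set_option maxHeartbeats 3200000 in -- MEASURED: four instances of the explicit trace formula and two cocycles; 1600 k fails
/-- **THE CHARACTER RELATION `tr ω₂ = -θ · tr ω₁` OFF `{±1}`.**  For two lines `δ₁`, `δ₂ = α δ₁` in different classes
(`(α, d₁)_v = -1`) there is a character `θ` of `U(J₁)(F_v)` with open kernel such that every `z ∉ {1, -1}` has a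
neighbourhood `z K₀` on which, for every open `L ≤ K₀`, `tr(ω_{s₂}(u) | 𝒮^L) = -θ(u) · tr(ω_{s₁}(u) | 𝒮^L)`:
the ratio `-Φ₂/Φ₁` of the explicit characters is multiplicative on the big cell by the Schur cocycles and the
cross-line sign `(α, d₁)_v = -1`, hence a character by Weil's extension trick on the infinite torus; its kernel is
open because the characters are locally constant. [cite: MoeglinVignerasWaldspurger1987, Chap. 3 §IV.4; Weil1964, Chap. I n° 14 Thm. 2, p. 161–163] -/
theorem rankOne_theta_character_ratio [MeasurableSpace (v.adicCompletion F)] [BorelSpace (v.adicCompletion F)]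
    (μ : Measure (v.adicCompletion F)) [μ.IsAddHaarMeasure] (m : ℤ) (hm : (adeleAddCharAt F v).HasConductorExp m)
    (hclass : hilbertSymbol (v.adicCompletion F) (α : v.adicCompletion F) (d₁ : v.adicCompletion F) = -1) :
    ∃ θ : localPi E c 1 J₁ v →* ℂˣ, IsOpen (θ.ker : Set (localPi E c 1 J₁ v)) ∧
      ∀ z : localPi E c 1 J₁ v, z ≠ 1 → z ≠ localUnitScalar E c J₁ v (-1) (negOne_mul_conjLocal_negOne E c v) →
        ∃ K₀ : Subgroup (localPi E c 1 J₁ v), IsOpen (K₀ : Set (localPi E c 1 J₁ v)) ∧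
          ∀ u : localPi E c 1 J₁ v, z⁻¹ * u ∈ K₀ →
            ∀ L : Subgroup (localPi E c 1 J₁ v), IsOpen (L : Set (localPi E c 1 J₁ v)) → L ≤ K₀ →
              LinearMap.trace ℂ (Representation.fixedPoints ((MpPsi.toRep (localSchrodinger F 1 t v)).comp s₂) L)
                  ((((MpPsi.toRep (localSchrodinger F 1 t v)).comp s₂) u).restrict
                    (apply_mem_fixedPoints_of_comm ((MpPsi.toRep (localSchrodinger F 1 t v)).comp s₂)
                      (localPi_one_mul_comm E c J₁ v) L u)) =
                -((((θ u : ℂˣ) : ℂ)) *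
                  LinearMap.trace ℂ (Representation.fixedPoints ((MpPsi.toRep (localSchrodinger F 1 t v)).comp s₁) L)
                    ((((MpPsi.toRep (localSchrodinger F 1 t v)).comp s₁) u).restrict
                      (apply_mem_fixedPoints_of_comm ((MpPsi.toRep (localSchrodinger F 1 t v)).comp s₁)
                        (localPi_one_mul_comm E c J₁ v) L u))) := by
  classical
  haveI : CharZero (v.adicCompletion F) := charZero_of_injective_algebraMap (algebraMap F _).injective
  have htwo : (2 : v.adicCompletion F) ≠ 0 := two_ne_zero
  haveI : Infinite (localPi E c 1 J₁ v) := infinite_localPi_rankOne F E c hcδ₁ hδ₁ hd₁ J₁ v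
  have hψ := isContinuousNontrivial_adeleAddCharAt F v
  have hq₁ := isQuadraticCoordinates_local E v c hcδ₁ hδ₁ hd₁
  have hcomm := localPi_one_mul_comm E c J₁ v
  set z₁ := localUnitScalar E c J₁ v (-1) (negOne_mul_conjLocal_negOne E c v) with hz₁
  have hl := isLocallyConstant_of_isContinuousNontrivial hψ
  have hJ₁' : J₁ 0 0 ≠ 0 := by
    rw [hJ₁, Matrix.map_apply, map_ne_zero_iff _ (algebraMap F E).injective, ← Matrix.det_fin_one t]; exact htd.ne_zero
  have hd₁F : d₁ ≠ 0 := fun h0 => by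
    have h := hd₁
    rw [h0, map_zero, mul_self_eq_zero] at h
    exact hδ₁ h
  have hd₁0 : (d₁ : v.adicCompletion F) ≠ 0 := (map_ne_zero_iff _ (algebraMap F (v.adicCompletion F)).injective).2 hd₁F
  have hα0' : (α : v.adicCompletion F) ≠ 0 := (map_ne_zero_iff _ (algebraMap F (v.adicCompletion F)).injective).2 hα0
  have hd₂' : (d₂ : v.adicCompletion F) = (α : v.adicCompletion F) ^ 2 * (d₁ : v.adicCompletion F) := by
    have h : algebraMap F E d₂ = algebraMap F E (α ^ 2 * d₁) := by rw [← hd₂, hα, map_mul, map_pow, ← hd₁]; ring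
    have h' := (algebraMap F E).injective h
    change algebraMap F (v.adicCompletion F) d₂ =
      algebraMap F (v.adicCompletion F) α ^ 2 * algebraMap F (v.adicCompletion F) d₁
    rw [h', map_mul, map_pow]
  -- ### coordinates
  have exA : ∃ f : localPi E c 1 J₁ v → v.adicCompletion F, ∀ u, f u =
      QuadraticCoordinates.re (quadraticLocalEquiv E v c hcδ₁ hδ₁).toLinearEquiv.toAddEquiv
        (fun w : PlacesOver E v => ((u : LocalGLPi E 1 v) w).val 0 0) := ⟨_, fun _ => rfl⟩
  have exB : ∃ f : localPi E c 1 J₁ v → v.adicCompletion F, ∀ u, f u =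
      QuadraticCoordinates.im (quadraticLocalEquiv E v c hcδ₁ hδ₁).toLinearEquiv.toAddEquiv
        (fun w : PlacesOver E v => ((u : LocalGLPi E 1 v) w).val 0 0) := ⟨_, fun _ => rfl⟩
  let aOf := exA.choose
  let bOf := exB.choose
  have haOf : ∀ u, aOf u = QuadraticCoordinates.re (quadraticLocalEquiv E v c hcδ₁ hδ₁).toLinearEquiv.toAddEquiv
        (fun w : PlacesOver E v => ((u : LocalGLPi E 1 v) w).val 0 0) := exA.choose_spec
  have hbOf : ∀ u, bOf u = QuadraticCoordinates.im (quadraticLocalEquiv E v c hcδ₁ hδ₁).toLinearEquiv.toAddEquiv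
        (fun w : PlacesOver E v => ((u : LocalGLPi E 1 v) w).val 0 0) := exB.choose_spec
  -- MARK1
  have hline₂ := fun u : localPi E c 1 J₁ v =>
    quadraticCoordinates_of_mul F E c δ₁ hcδ₁ hδ₁ d₁ hd₁ v hcδ₂ hδ₂ hα0 hα (fun w : PlacesOver E v => ((u : LocalGLPi E 1 v) w).val 0 0)
  have haOf₂ : ∀ u, aOf u = QuadraticCoordinates.re (quadraticLocalEquiv E v c hcδ₂ hδ₂).toLinearEquiv.toAddEquiv
      (fun w : PlacesOver E v => ((u : LocalGLPi E 1 v) w).val 0 0) := fun u => by rw [(hline₂ u).1, haOf]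
  have hbOf₂ : ∀ u, (α : v.adicCompletion F)⁻¹ * bOf u =
      QuadraticCoordinates.im (quadraticLocalEquiv E v c hcδ₂ hδ₂).toLinearEquiv.toAddEquiv
        (fun w : PlacesOver E v => ((u : LocalGLPi E 1 v) w).val 0 0) := fun u => by rw [(hline₂ u).2, hbOf]
  -- MARK2
  -- norm one, products
  have hnorm : ∀ u, aOf u ^ 2 - (d₁ : v.adicCompletion F) * bOf u ^ 2 = 1 := fun u => by
    rw [haOf, hbOf]; exact rankOne_re_sq_sub E c J₁ v hJ₁' hcδ₁ hδ₁ hd₁ u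
  have hmulcoord : ∀ x y, aOf (x * y) = aOf x * aOf y + (d₁ : v.adicCompletion F) * (bOf x * bOf y) ∧
      bOf (x * y) = aOf x * bOf y + bOf x * aOf y := by
    intro x y
    rw [haOf, hbOf, haOf, hbOf, haOf, hbOf, rankOne_scalar_mul, hq₁.re_mul, hq₁.im_mul]
    exact ⟨rfl, rfl⟩
  -- `b = 0` at `1` and `z₁`; `b ≠ 0` elsewhere (non-split)
  have hb1 : bOf 1 = 0 := by
    rw [hbOf]
    have h1 : (fun w : PlacesOver E v => (((1 : localPi E c 1 J₁ v) : LocalGLPi E 1 v) w).val 0 0 : LocalRing E v) = 1 := by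
      funext w; exact rankOne_entry_one E c J₁ v w
    rw [h1]; exact hq₁.im_one
  have hbz₁ : bOf z₁ = 0 := by
    rw [hbOf]
    have h1 : (fun w : PlacesOver E v => ((z₁ : LocalGLPi E 1 v) w).val 0 0 : LocalRing E v) = -1 := by
      funext w; rw [hz₁, coe_localUnitScalar_apply, Units.val_neg, Units.val_one]
    rw [h1, map_neg, hq₁.im_one, neg_zero]
  have hgood : ∀ u, bOf u ≠ 0 → u ≠ 1 ∧ u ≠ z₁ := fun u hu =>
    ⟨fun h => hu (by rw [h, hb1]), fun h => hu (by rw [h, hbz₁])⟩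
  have hΩ : ∀ u, bOf u ≠ 0 → u * u ≠ 1 := by
    intro u hu huu
    rcases rankOne_eq_one_or_eq_negOne_of_mul_self_eq_one F E c J₁ v hE u huu with h | h
    · exact (hgood u hu).1 h
    · exact (hgood u hu).2 (by rw [hz₁]; exact h)
  have hbne : ∀ u, u ≠ 1 → u ≠ z₁ → bOf u ≠ 0 := by
    intro u h1 h2
    have huu : u * u ≠ 1 := by
      intro huu
      rcases rankOne_eq_one_or_eq_negOne_of_mul_self_eq_one F E c J₁ v hE u huu with h | h
      · exact h1 h
      · exact h2 (by rw [hz₁]; exact h)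
    rw [hbOf]; exact rankOne_im_ne_zero_of_mul_self_ne_one E c J₁ v hJ₁' hcδ₁ hδ₁ hd₁ u huu
  have hτ0 : localGram F 1 t v 0 0 ≠ 0 := by
    have h := (UnitaryGroup.isUnit_det_map (algebraMap F (v.adicCompletion F)) htd).ne_zero
    rwa [Matrix.det_fin_one] at h
  have hβ₁ : ∀ u, bOf u ≠ 0 → (d₁ : v.adicCompletion F) * bOf u * (localGram F 1 t v 0 0)⁻¹ ≠ 0 := fun u hu =>
    mul_ne_zero (mul_ne_zero hd₁0 hu) (inv_ne_zero hτ0)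
  have hβ₂ : ∀ u, bOf u ≠ 0 → (d₂ : v.adicCompletion F) * ((α : v.adicCompletion F)⁻¹ * bOf u) * (localGram F 1 t v 0 0)⁻¹ ≠ 0 := fun u hu => by
    rw [hd₂']; exact mul_ne_zero (mul_ne_zero (mul_ne_zero (pow_ne_zero 2 hα0') hd₁0) (mul_ne_zero (inv_ne_zero hα0') hu))
      (inv_ne_zero hτ0)
  have h1a : ∀ u, bOf u ≠ 0 → 1 - aOf u ≠ 0 := by
    intro u hu h0
    have ha1 : aOf u = 1 := by linear_combination -h0
    have h := hnorm u
    rw [ha1] at h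
    have : (d₁ : v.adicCompletion F) * bOf u ^ 2 = 0 := by linear_combination -h
    rcases mul_eq_zero.1 this with h' | h'
    · exact hd₁0 h'
    · exact hu (pow_eq_zero_iff (two_ne_zero) |>.1 h')
  -- ### the Schur scalars
  have key₁ : ∀ u : localPi E c 1 J₁ v, bOf u ≠ 0 → ∃ lam : ℂˣ, ∀ f : SchwartzBruhat (Fin 1 → v.adicCompletion F),
      ((MpPsi.toRep (localSchrodinger F 1 t v)).comp s₁) u f = (lam : ℂ) • bigCellOp hl μ hψ hm
        (symplecticConj (gramProd (localGram F 1 t v) (UnitaryGroup.isUnit_det_map (algebraMap F (v.adicCompletion F)) htd))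
          (polar_dotProductBilin_gramProd (localGram F 1 t v) (UnitaryGroup.isUnit_det_map (algebraMap F (v.adicCompletion F)) htd))
          (iota F E c 1 hcδ₁ hδ₁ hd₁ t ht hJ₁ v u)) f := by
    intro u hu
    have hB := rankOne_blockB_bijective E c hcδ₁ hδ₁ hd₁ t ht htd hJ₁ v u _ rfl (by rw [← hbOf]; exact hβ₁ u hu)
    obtain ⟨lam, hlam⟩ := rankOne_exists_scalar_bigCellWord F E c hcδ₁ hδ₁ hd₁ t ht htd hJ₁ v μ hm s₁ hs₁ u _ rfl hB
    exact ⟨lam, fun f => by rw [bigCellOp_of_bijective hl μ hψ hm _ hB]; exact hlam f⟩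
  have key₂ : ∀ u : localPi E c 1 J₁ v, bOf u ≠ 0 → ∃ lam : ℂˣ, ∀ f : SchwartzBruhat (Fin 1 → v.adicCompletion F),
      ((MpPsi.toRep (localSchrodinger F 1 t v)).comp s₂) u f = (lam : ℂ) • bigCellOp hl μ hψ hm
        (symplecticConj (gramProd (localGram F 1 t v) (UnitaryGroup.isUnit_det_map (algebraMap F (v.adicCompletion F)) htd))
          (polar_dotProductBilin_gramProd (localGram F 1 t v) (UnitaryGroup.isUnit_det_map (algebraMap F (v.adicCompletion F)) htd))
          (iota F E c 1 hcδ₂ hδ₂ hd₂ t ht hJ₁ v u)) f := by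
    intro u hu
    have hB := rankOne_blockB_bijective E c hcδ₂ hδ₂ hd₂ t ht htd hJ₁ v u _ rfl (by rw [← hbOf₂]; exact hβ₂ u hu)
    obtain ⟨lam, hlam⟩ := rankOne_exists_scalar_bigCellWord F E c hcδ₂ hδ₂ hd₂ t ht htd hJ₁ v μ hm s₂ hs₂ u _ rfl hB
    exact ⟨lam, fun f => by rw [bigCellOp_of_bijective hl μ hψ hm _ hB]; exact hlam f⟩
  choose! lam₁ hlam₁ using key₁
  choose! lam₂ hlam₂ using key₂
  -- ### the explicit characters `Φ₁, Φ₂` and the ratio `f = -Φ₂/Φ₁`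
  have exΦ₁ : ∃ Φ : localPi E c 1 J₁ v → ℂ, ∀ u, Φ u = (lam₁ u : ℂ) *
      ((Real.sqrt (normAbs (v.adicCompletion F) ((d₁ : v.adicCompletion F) * bOf u * (localGram F 1 t v 0 0)⁻¹)) : ℝ) : ℂ)⁻¹ *
        weilGauss (adeleAddCharAt F v) μ (((d₁ : v.adicCompletion F) * bOf u * (localGram F 1 t v 0 0)⁻¹)⁻¹ * (1 - aOf u)) := ⟨_, fun _ => rfl⟩
  have exΦ₂ : ∃ Φ : localPi E c 1 J₁ v → ℂ, ∀ u, Φ u = (lam₂ u : ℂ) *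
      ((Real.sqrt (normAbs (v.adicCompletion F)
        ((d₂ : v.adicCompletion F) * ((α : v.adicCompletion F)⁻¹ * bOf u) * (localGram F 1 t v 0 0)⁻¹)) : ℝ) : ℂ)⁻¹ *
        weilGauss (adeleAddCharAt F v) μ
          (((d₂ : v.adicCompletion F) * ((α : v.adicCompletion F)⁻¹ * bOf u) * (localGram F 1 t v 0 0)⁻¹)⁻¹ * (1 - aOf u)) := ⟨_, fun _ => rfl⟩
  let Φ₁ := exΦ₁.choose
  let Φ₂ := exΦ₂.choose
  have hΦ₁ : ∀ u, Φ₁ u = (lam₁ u : ℂ) *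
      ((Real.sqrt (normAbs (v.adicCompletion F) ((d₁ : v.adicCompletion F) * bOf u * (localGram F 1 t v 0 0)⁻¹)) : ℝ) : ℂ)⁻¹ *
        weilGauss (adeleAddCharAt F v) μ (((d₁ : v.adicCompletion F) * bOf u * (localGram F 1 t v 0 0)⁻¹)⁻¹ * (1 - aOf u)) :=
    exΦ₁.choose_spec
  have hΦ₂ : ∀ u, Φ₂ u = (lam₂ u : ℂ) *
      ((Real.sqrt (normAbs (v.adicCompletion F)
        ((d₂ : v.adicCompletion F) * ((α : v.adicCompletion F)⁻¹ * bOf u) * (localGram F 1 t v 0 0)⁻¹)) : ℝ) : ℂ)⁻¹ *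
        weilGauss (adeleAddCharAt F v) μ
          (((d₂ : v.adicCompletion F) * ((α : v.adicCompletion F)⁻¹ * bOf u) * (localGram F 1 t v 0 0)⁻¹)⁻¹ * (1 - aOf u)) :=
    exΦ₂.choose_spec
  have hsq0 : ∀ {x : v.adicCompletion F}, x ≠ 0 → ((Real.sqrt (normAbs (v.adicCompletion F) x) : ℝ) : ℂ) ≠ 0 := by
    intro x hx
    rw [Complex.ofReal_ne_zero]
    have hpos : 0 < normAbs (v.adicCompletion F) x := pos_iff_ne_zero.2 ((map_ne_zero _).2 hx)
    exact (Real.sqrt_pos.2 (by exact_mod_cast hpos)).ne'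
  have hΦ₁0 : ∀ u, bOf u ≠ 0 → Φ₁ u ≠ 0 := fun u hu => by
    rw [hΦ₁]
    exact mul_ne_zero (mul_ne_zero (lam₁ u).ne_zero (inv_ne_zero (hsq0 (hβ₁ u hu))))
      (weilGauss_ne_zero μ hψ (mul_ne_zero (inv_ne_zero (hβ₁ u hu)) (h1a u hu)) htwo)
  have hΦ₂0 : ∀ u, bOf u ≠ 0 → Φ₂ u ≠ 0 := fun u hu => by
    rw [hΦ₂]
    exact mul_ne_zero (mul_ne_zero (lam₂ u).ne_zero (inv_ne_zero (hsq0 (hβ₂ u hu))))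
      (weilGauss_ne_zero μ hψ (mul_ne_zero (inv_ne_zero (hβ₂ u hu)) (h1a u hu)) htwo)
  let f : localPi E c 1 J₁ v → ℂ := fun u => -(Φ₂ u / Φ₁ u)
  have hf : ∀ u, f u = -(Φ₂ u / Φ₁ u) := fun u => rfl
  have hf0 : ∀ x, x ≠ 1 → x ≠ z₁ → f x ≠ 0 := fun x h1 h2 => by
    have hb := hbne x h1 h2
    exact neg_ne_zero.2 (div_ne_zero (hΦ₂0 x hb) (hΦ₁0 x hb))
  -- ### multiplicativity on the big cell
  have hmul : ∀ x y, x ≠ 1 → x ≠ z₁ → y ≠ 1 → y ≠ z₁ → x * y ≠ 1 → x * y ≠ z₁ → f (x * y) = f x * f y := by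
    intro x y hx1 hx2 hy1 hy2 hxy1 hxy2
    have hbx := hbne x hx1 hx2
    have hby := hbne y hy1 hy2
    have hbxy := hbne (x * y) hxy1 hxy2
    obtain ⟨haxy, hbxy'⟩ := hmulcoord x y
    have hβ'' : (d₁ : v.adicCompletion F) * (aOf x * bOf y + bOf x * aOf y) * (localGram F 1 t v 0 0)⁻¹ ≠ 0 := by
      rw [← hbxy']; exact hβ₁ _ hbxy
    have hβ₂'' : (d₂ : v.adicCompletion F) * (aOf x * ((α : v.adicCompletion F)⁻¹ * bOf y) +
        (α : v.adicCompletion F)⁻¹ * bOf x * aOf y) * (localGram F 1 t v 0 0)⁻¹ ≠ 0 := by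
      have e : (d₂ : v.adicCompletion F) * (aOf x * ((α : v.adicCompletion F)⁻¹ * bOf y) +
          (α : v.adicCompletion F)⁻¹ * bOf x * aOf y) * (localGram F 1 t v 0 0)⁻¹ =
          (d₂ : v.adicCompletion F) * ((α : v.adicCompletion F)⁻¹ * bOf (x * y)) * (localGram F 1 t v 0 0)⁻¹ := by rw [hbxy']; ring
      rw [e]; exact hβ₂ _ hbxy
    -- the two cocycles
    have hcoc₁ := rankOne_scalar_cocycle F E c δ₁ hcδ₁ hδ₁ d₁ hd₁ t ht htd J₁ hJ₁ v s₁ μ m hm x y (aOf x) (bOf x)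
      (aOf y) (bOf y) (haOf x) (hbOf x) (haOf y) (hbOf y) (hβ₁ x hbx) (hβ₁ y hby) hβ''
      (lam₁ x) (lam₁ y) (lam₁ (x * y)) (hlam₁ x hbx) (hlam₁ y hby) (hlam₁ (x * y) hbxy)
    have hcoc₂ := rankOne_scalar_cocycle F E c δ₂ hcδ₂ hδ₂ d₂ hd₂ t ht htd J₁ hJ₁ v s₂ μ m hm x y (aOf x)
      ((α : v.adicCompletion F)⁻¹ * bOf x) (aOf y) ((α : v.adicCompletion F)⁻¹ * bOf y)
      (haOf₂ x) (hbOf₂ x) (haOf₂ y) (hbOf₂ y) (hβ₂ x hbx) (hβ₂ y hby) hβ₂''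
      (lam₂ x) (lam₂ y) (lam₂ (x * y)) (hlam₂ x hbx) (hlam₂ y hby) (hlam₂ (x * y) hbxy)
    rw [invOf_eq_inv] at hcoc₁ hcoc₂
    have hX := crossLine_character_identity F v μ hψ hα0' hd₂' rfl rfl (hnorm x) (hnorm y) (hβ₁ x hbx) (hβ₁ y hby) hβ''
      (h1a x hbx) (h1a y hby) (by rw [← haxy]; exact h1a _ hbxy)
      (lam₁ x) (lam₁ y) (lam₁ (x * y)) (lam₂ x) (lam₂ y) (lam₂ (x * y)) hcoc₁ hcoc₂
    rw [hclass] at hX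
    -- read the identity on `Φ`
    have e₂ : (d₂ : v.adicCompletion F) * (aOf x * ((α : v.adicCompletion F)⁻¹ * bOf y) +
        (α : v.adicCompletion F)⁻¹ * bOf x * aOf y) * (localGram F 1 t v 0 0)⁻¹ =
        (d₂ : v.adicCompletion F) * ((α : v.adicCompletion F)⁻¹ * bOf (x * y)) * (localGram F 1 t v 0 0)⁻¹ := by rw [hbxy']; ring
    have e₃ : 1 - (aOf x * aOf y + (d₂ : v.adicCompletion F) *
        ((α : v.adicCompletion F)⁻¹ * bOf x * ((α : v.adicCompletion F)⁻¹ * bOf y))) = 1 - aOf (x * y) := by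
      rw [haxy, hd₂']; field_simp
    rw [e₂, e₃, ← haxy, ← hbxy'] at hX
    rw [← hΦ₁ x, ← hΦ₁ y, ← hΦ₁ (x * y), ← hΦ₂ x, ← hΦ₂ y, ← hΦ₂ (x * y)] at hX
    have h1 := hΦ₁0 x hbx; have h2 := hΦ₁0 y hby; have h3 := hΦ₁0 (x * y) hbxy
    rw [hf, hf, hf]
    field_simp
    push_cast at hX
    linear_combination -hX
  -- ### the character
  have exθ := exists_monoidHom_eq_off_pair hcomm z₁ f hf0 hmul
  have hθ := exθ.choose_spec
  -- restricted operators do not see `k ∈ L`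
  have hrestr₁ : ∀ (L : Subgroup (localPi E c 1 J₁ v)) (u k : localPi E c 1 J₁ v), k ∈ L →
      (((MpPsi.toRep (localSchrodinger F 1 t v)).comp s₁) (u * k)).restrict
          (apply_mem_fixedPoints_of_comm ((MpPsi.toRep (localSchrodinger F 1 t v)).comp s₁) hcomm L (u * k)) =
        (((MpPsi.toRep (localSchrodinger F 1 t v)).comp s₁) u).restrict
          (apply_mem_fixedPoints_of_comm ((MpPsi.toRep (localSchrodinger F 1 t v)).comp s₁) hcomm L u) := by
    intro L u k hk
    apply LinearMap.ext; intro w; apply Subtype.ext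
    simp only [LinearMap.coe_restrict_apply]
    rw [map_mul, Module.End.mul_apply,
      (Representation.mem_fixedPoints ((MpPsi.toRep (localSchrodinger F 1 t v)).comp s₁) L (w : _)).1 w.2 k hk]
  have hrestr₂ : ∀ (L : Subgroup (localPi E c 1 J₁ v)) (u k : localPi E c 1 J₁ v), k ∈ L →
      (((MpPsi.toRep (localSchrodinger F 1 t v)).comp s₂) (u * k)).restrict
          (apply_mem_fixedPoints_of_comm ((MpPsi.toRep (localSchrodinger F 1 t v)).comp s₂) hcomm L (u * k)) =
        (((MpPsi.toRep (localSchrodinger F 1 t v)).comp s₂) u).restrict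
          (apply_mem_fixedPoints_of_comm ((MpPsi.toRep (localSchrodinger F 1 t v)).comp s₂) hcomm L u) := by
    intro L u k hk
    apply LinearMap.ext; intro w; apply Subtype.ext
    simp only [LinearMap.coe_restrict_apply]
    rw [map_mul, Module.End.mul_apply,
      (Representation.mem_fixedPoints ((MpPsi.toRep (localSchrodinger F 1 t v)).comp s₂) L (w : _)).1 w.2 k hk]
  refine ⟨exθ.choose, ?_, ?_⟩
  · -- ### the kernel of `θ` is open: `θ` is constant on a coset `z₀ K₀`
    have ez := exists_mul_self_ne_one F E c hcδ₁ hδ₁ J₁ v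
    have hz₀ : ez.choose * ez.choose ≠ 1 := ez.choose_spec
    have W₁ := rankOne_trace_fixedPoints_eq F E c δ₁ hcδ₁ hδ₁ d₁ hd₁ t ht htd J₁ hJ₁ v hE s₁ hs₁ hsm₁ ez.choose hz₀ μ m hm
    have W₂ := rankOne_trace_fixedPoints_eq F E c δ₂ hcδ₂ hδ₂ d₂ hd₂ t ht htd J₁ hJ₁ v hE s₂ hs₂ hsm₂ ez.choose hz₀ μ m hm
    have hK₁o := W₁.choose_spec.1
    have hK₂o := W₂.choose_spec.1
    have hKo : IsOpen ((W₁.choose ⊓ W₂.choose : Subgroup (localPi E c 1 J₁ v)) : Set (localPi E c 1 J₁ v)) := by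
      rw [Subgroup.coe_inf]; exact hK₁o.inter hK₂o
    refine isOpen_ker_of_const_on_coset exθ.choose (W₁.choose ⊓ W₂.choose) hKo ez.choose fun k hk => ?_
    have hk₁ : k ∈ W₁.choose := (Subgroup.mem_inf.1 hk).1
    have hk₂ : k ∈ W₂.choose := (Subgroup.mem_inf.1 hk).2
    -- the trace formulas at `z₀ k` and at `z₀ 1`
    have T₁ := W₁.choose_spec.2 k hk₁ (aOf (ez.choose * k)) (bOf (ez.choose * k)) (haOf _) (hbOf _)
    have T₁' := W₁.choose_spec.2 1 W₁.choose.one_mem (aOf (ez.choose * 1)) (bOf (ez.choose * 1)) (haOf _) (hbOf _)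
    have T₂ := W₂.choose_spec.2 k hk₂ (aOf (ez.choose * k)) ((α : v.adicCompletion F)⁻¹ * bOf (ez.choose * k))
      (haOf₂ _) (hbOf₂ _)
    have T₂' := W₂.choose_spec.2 1 W₂.choose.one_mem (aOf (ez.choose * 1))
      ((α : v.adicCompletion F)⁻¹ * bOf (ez.choose * 1)) (haOf₂ _) (hbOf₂ _)
    have hbk : bOf (ez.choose * k) ≠ 0 := (mul_ne_zero_iff.1 (mul_ne_zero_iff.1 T₁.1).1).2
    have hb1' : bOf (ez.choose * 1) ≠ 0 := (mul_ne_zero_iff.1 (mul_ne_zero_iff.1 T₁'.1).1).2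
    have t₁ := T₁.2 _ hKo inf_le_left (lam₁ _) (hlam₁ _ hbk)
    have t₁' := T₁'.2 _ hKo inf_le_left (lam₁ _) (hlam₁ _ hb1')
    have t₂ := T₂.2 _ hKo inf_le_right (lam₂ _) (hlam₂ _ hbk)
    have t₂' := T₂'.2 _ hKo inf_le_right (lam₂ _) (hlam₂ _ hb1')
    have r₁ := hrestr₁ (W₁.choose ⊓ W₂.choose) ez.choose k hk
    have r₁' := hrestr₁ (W₁.choose ⊓ W₂.choose) ez.choose 1 (Subgroup.one_mem _)
    have r₂ := hrestr₂ (W₁.choose ⊓ W₂.choose) ez.choose k hk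
    have r₂' := hrestr₂ (W₁.choose ⊓ W₂.choose) ez.choose 1 (Subgroup.one_mem _)
    have e₁ : Φ₁ (ez.choose * k) = Φ₁ (ez.choose * 1) :=
      ((hΦ₁ _).trans t₁.symm).trans (((congrArg (LinearMap.trace ℂ _) (r₁.trans r₁'.symm))).trans
        (t₁'.trans (hΦ₁ _).symm))
    have e₂ : Φ₂ (ez.choose * k) = Φ₂ (ez.choose * 1) :=
      ((hΦ₂ _).trans t₂.symm).trans (((congrArg (LinearMap.trace ℂ _) (r₂.trans r₂'.symm))).trans
        (t₂'.trans (hΦ₂ _).symm))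
    have hgk := hgood _ hbk
    have hg1 := hgood _ hb1'
    rw [mul_one] at e₁ e₂ hg1
    apply Units.ext
    rw [hθ _ hgk.1 hgk.2, hθ _ hg1.1 hg1.2, hf, hf, e₁, e₂]
  · -- ### the relation near `z ∉ {1, z₁}`
    intro z hz1 hz2
    have hbz := hbne z hz1 hz2
    have hzz := hΩ z hbz
    have W₁ := rankOne_trace_fixedPoints_eq F E c δ₁ hcδ₁ hδ₁ d₁ hd₁ t ht htd J₁ hJ₁ v hE s₁ hs₁ hsm₁ z hzz μ m hm
    have W₂ := rankOne_trace_fixedPoints_eq F E c δ₂ hcδ₂ hδ₂ d₂ hd₂ t ht htd J₁ hJ₁ v hE s₂ hs₂ hsm₂ z hzz μ m hm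
    have hK₁o := W₁.choose_spec.1
    have hK₂o := W₂.choose_spec.1
    have hKo : IsOpen ((W₁.choose ⊓ W₂.choose : Subgroup (localPi E c 1 J₁ v)) : Set (localPi E c 1 J₁ v)) := by
      rw [Subgroup.coe_inf]; exact hK₁o.inter hK₂o
    refine ⟨W₁.choose ⊓ W₂.choose, hKo, fun u hu L hLo hLK => ?_⟩
    have key : ∀ k : localPi E c 1 J₁ v, z * k = u → k ∈ W₁.choose ⊓ W₂.choose →
        LinearMap.trace ℂ (Representation.fixedPoints ((MpPsi.toRep (localSchrodinger F 1 t v)).comp s₂) L)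
            ((((MpPsi.toRep (localSchrodinger F 1 t v)).comp s₂) u).restrict
              (apply_mem_fixedPoints_of_comm ((MpPsi.toRep (localSchrodinger F 1 t v)).comp s₂) hcomm L u)) =
          -((((exθ.choose u : ℂˣ) : ℂ)) *
            LinearMap.trace ℂ (Representation.fixedPoints ((MpPsi.toRep (localSchrodinger F 1 t v)).comp s₁) L)
              ((((MpPsi.toRep (localSchrodinger F 1 t v)).comp s₁) u).restrict
                (apply_mem_fixedPoints_of_comm ((MpPsi.toRep (localSchrodinger F 1 t v)).comp s₁) hcomm L u))) := by
      intro k hk hkK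
      subst hk
      have hk₁ : k ∈ W₁.choose := (Subgroup.mem_inf.1 hkK).1
      have hk₂ : k ∈ W₂.choose := (Subgroup.mem_inf.1 hkK).2
      have T₁ := W₁.choose_spec.2 k hk₁ (aOf (z * k)) (bOf (z * k)) (haOf _) (hbOf _)
      have T₂ := W₂.choose_spec.2 k hk₂ (aOf (z * k)) ((α : v.adicCompletion F)⁻¹ * bOf (z * k)) (haOf₂ _) (hbOf₂ _)
      have hbu : bOf (z * k) ≠ 0 := (mul_ne_zero_iff.1 (mul_ne_zero_iff.1 T₁.1).1).2
      have hgu := hgood (z * k) hbu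
      have t₁ := T₁.2 L hLo (hLK.trans inf_le_left) (lam₁ (z * k)) (hlam₁ _ hbu)
      have t₂ := T₂.2 L hLo (hLK.trans inf_le_right) (lam₂ (z * k)) (hlam₂ _ hbu)
      refine t₂.trans ?_
      rw [t₁, hθ _ hgu.1 hgu.2, hf, hΦ₁ (z * k), hΦ₂ (z * k)]
      have h0 := hΦ₁0 (z * k) hbu
      rw [hΦ₁] at h0
      rw [neg_mul, neg_neg, div_mul_cancel₀ _ h0]
    exact key (z⁻¹ * u) (mul_inv_cancel_left z u) hu

end TwoLines

end Literature.RepresentationTheory.MoeglinVignerasWaldspurger1987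

end
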